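import Summits.BirchSwinnertonDyer.BirchSwinnertonDyer.Theses.LeadingTerm
import Summits.BirchSwinnertonDyer.BirchSwinnertonDyer.Theorems.LeadingTermPinchPrimeCofiniteTorsion
import Summits.BirchSwinnertonDyer.BirchSwinnertonDyer.Theorems.LeadingTermPinchPrimeSemisimpleOrder
import Summits.BirchSwinnertonDyer.BirchSwinnertonDyer.Theorems.LeadingTermPinchPrimeSemisimpleOfSchneiderAt
import Literature.NumberTheory.EllipticCurves.IwasawaSelmerDualProofs
import Literature.NumberTheory.EllipticCurves.SelmerInftyTorsionFiniteProofs
import Literature.NumberTheory.EllipticCurves.KatoRankBoundProofs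
import Literature.NumberTheory.EllipticCurves.CanonicalPAdicHeightHolds
import Literature.NumberTheory.EllipticCurves.ModPIrreducibleCofinite

/-!
# BirchSwinnertonDyer / LeadingTerm — crux `PinchPrime` (stmt-BirchSwinnertonDyer-16218),
# line `SketchIdeator2`, stub `stub_semisimpleInfinitelyOften_iff_schneiderInfinitelyOften`
# (GLUE, v8: the line's open height-side stub, curve by curve, IS "Schneider non-degeneracy at
# infinitely many good ordinary primes", given cofinite finiteness of `Ш[p^∞]`)

Registered stub of the lead skeleton `Cruxes/PinchPrime/Lines/SketchIdeator2.lean` (v8). The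
line reduces the crux to two OPEN stubs: (A) `Ш(E/ℚ)[p^∞]` finite for all good ordinary `p`
outside a finite set, and (B) at infinitely many good ordinary `p ≥ 5`, with the normalised
cyclotomic datum `(κ, γ)`, multiplication by `T = γ - 1` is semisimple at `0` on
`ℚ_p ⊗ X(E/ℚ_∞)` for every Iwasawa datum (`ker T² = ker T`; Greenberg, LNM 1716, §1 Conj. 1.12
at `T = 0`). This file identifies (B), for a curve satisfying (A), with a classical statement:
**Schneider non-degeneracy of the canonical cyclotomic `p`-adic height at infinitely many good
ordinary primes `p ≥ 5`** (the `∃^∞ p` form of Schneider 1982 §1 / Mazur–Stein–Tate 2006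
Conj. 1.1) — modulo the four named facts Perrin-Riou–Schneider
(`Schneider1985_order_charGenerator`), Mazur's control theorem in corank form
(`Greenberg1999_coinvariantsRank_eq_selmerCorank_rat`), modularity (`exists_isNewformOf`) and BCS
(`burungale_castella_skinner_charIdeal_eq_padicLFunction`), all HYPOTHESES (the four arrows).

* (B ⟹ Schneider i.o.) at a semisimple prime outside the `Ш`- and torsion-exceptional sets,
  `ord_T f_E = rank` (`stub_semisimpleOrder`, LANDED p133143) and PRS clause 2 gives `Reg_p ≠ 0`
  for every canonical datum;
* (Schneider i.o. ⟹ B) at a Schneider prime outside the exceptional sets, for every Iwasawa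
  datum `ord_T f_E = rank` by PRS and the corank squeeze forces `ker T² = ker T`
  (`stub_semisimpleOfSchneiderAt`, LANDED p134208); the normalised cyclotomic datum exists at
  every `p` (`exists_isCyclotomic_isTopGenerator_isCyclotomicVariable_holds`).
"Infinitely many" is written, as everywhere in the line, as `∀ B : Finset ℕ, ∃ p ∉ B, …`.
-/

noncomputable section

set_option linter.dupNamespace false

namespace Summit.BirchSwinnertonDyer.BirchSwinnertonDyer.Cruxes.PinchPrime.FirstLayerStability

open scoped MatrixGroups ModularForm
open CongruenceSubgroup Literature.NumberTheory.EllipticCurves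
  Literature.NumberTheory.EllipticCurves.ModularForms
open Summit.BirchSwinnertonDyer.BirchSwinnertonDyer.Theses

/-- **Semisimplicity infinitely often ⟺ Schneider infinitely often**, curve by curve, given
cofinite finiteness of `Ш[p^∞]` (stub `stub_semisimpleInfinitelyOften_iff_schneiderInfinitelyOften`
of crux `PinchPrime`, line `SketchIdeator2`). Assume PRS, the control fact, modularity and BCS.
Let `E/ℚ` be elliptic with globally minimal `W` and suppose `Ш(E/ℚ)[p^∞]` is finite for every
good ordinary `p` outside a finite set. Then the following are equivalent: (B) outside every
finite set there is a good ordinary `p ≥ 5` with a cyclotomic `ℤ_p`-extension `κ` and a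
normalised topological generator `γ` such that `ker T² = ker T` on `ℚ_p ⊗ X` for every Iwasawa
datum; (S) outside every finite set there is a good ordinary `p ≥ 5` at which every canonical
cyclotomic height datum has `Reg_p ≠ 0`. [cite: GreenbergLNM1716, §1 Conj. 1.12 and p. 9]
[cite: BalakrishnanMullerStein2015, Thm. 1.7] [cite: MazurSteinTate2006, Conj. 1.1] -/
theorem stub_semisimpleInfinitelyOften_iff_schneiderInfinitelyOften :
    Schneider1985_order_charGenerator → Greenberg1999_coinvariantsRank_eq_selmerCorank_rat →
    exists_isNewformOf → burungale_castella_skinner_charIdeal_eq_padicLFunction →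
    ∀ (W : WeierstrassCurve ℚ) [W.IsElliptic] [W.IsGloballyMinimal],
      (∃ B : Finset ℕ, ∀ p ∉ B, ∀ [Fact p.Prime], IsOrdinaryAt W p →
        Finite (AddCommGroup.primaryComponent W.sha p)) →
      ((∀ B : Finset ℕ, ∃ p ∉ B, ∃ _ : Fact p.Prime, 5 ≤ p ∧ IsOrdinaryAt W p ∧
          ∃ (κ : ZpExtension ℚ p) (γ : Field.absoluteGaloisGroup ℚ),
            κ.IsCyclotomic ∧ κ.IsTopGenerator γ ∧ IsCyclotomicVariable p γ ∧
            ∀ D : W.SelmerDualData κ γ,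
              LinearMap.ker (IwasawaAlgebra.mulTRat p D.X ∘ₗ IwasawaAlgebra.mulTRat p D.X)
                = LinearMap.ker (IwasawaAlgebra.mulTRat p D.X)) ↔
        (∀ B : Finset ℕ, ∃ p ∉ B, ∃ _ : Fact p.Prime, 5 ≤ p ∧ IsOrdinaryAt W p ∧
          ∀ Dh : WeierstrassCurve.PAdicHeightData W p, Dh.IsCanonical →
            WeierstrassCurve.SchneiderConjecture Dh)) := by
  intro hPRS hcontrol hmod hBCS W _ _ hSha
  obtain ⟨B₁, hB₁⟩ := hSha
  obtain ⟨B₃, hB₃⟩ := stub_cofiniteTorsion hBCS W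
  haveI : NeZero (W.conductorNorm ℤ) := ⟨(WeierstrassCurve.conductorNorm_pos_holds (W := W)).ne'⟩
  obtain ⟨f, hf⟩ := hmod W
  constructor
  · -- (B ⟹ S): at a semisimple prime outside the exceptional sets, `ord_T f_E = rank`, then PRS
    intro hB B
    obtain ⟨p, hpB, hp, h5, hord, κ, γ, hκ, hγ, hγ', hss⟩ := hB (B ∪ B₁ ∪ B₃)
    simp only [Finset.mem_union, not_or] at hpB
    obtain ⟨⟨hp0, hp1⟩, hp3⟩ := hpB
    haveI : Fact p.Prime := hp
    refine ⟨p, hp0, hp, h5, hord, fun Dh hDh ↦ ?_⟩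
    obtain ⟨D⟩ := W.nonempty_selmerDualData_holds κ γ hγ
    haveI : Module.Finite (IwasawaAlgebra p) D.X := D.module_finite_of_isCyclotomic W κ hκ hγ
    obtain ⟨fE, hfE⟩ : ∃ fE : IwasawaAlgebra p, D.charIdeal = Ideal.span {fE} := by
      have hP : (D.charIdeal).IsPrincipal := charIdeal_isPrincipal_holds p D.X
      exact ⟨hP.generator, (Ideal.span_singleton_generator D.charIdeal).symm⟩
    have htors : D.IsTorsion := hB₃ p hp3 h5 hord κ γ hκ hγ hγ' f hf D
    have hsha : Finite (AddCommGroup.primaryComponent W.sha p) := hB₁ p hp1 hord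
    have horder : fE.order = W.mordellWeilRank :=
      stub_semisimpleOrder hcontrol W p h5 hord κ γ hκ hγ D htors (hss D) hsha fE hfE
    exact ((Schneider1985_order_charGenerator.order_eq_iff hPRS h5 hord.1 hord.2 hκ hγ hγ' D
      htors hfE hDh).mp horder).1
  · -- (S ⟹ B): at a Schneider prime outside the exceptional sets, the corank squeeze
    intro hS B
    obtain ⟨p, hpB, hp, h5, hord, hSch⟩ := hS (B ∪ B₁ ∪ B₃)
    simp only [Finset.mem_union, not_or] at hpB
    obtain ⟨⟨hp0, hp1⟩, hp3⟩ := hpB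
    haveI : Fact p.Prime := hp
    obtain ⟨κ, hκ, γ, hγ, hγ'⟩ := exists_isCyclotomic_isTopGenerator_isCyclotomicVariable_holds p
    obtain ⟨Dh, hDh⟩ := WeierstrassCurve.exists_isCanonical_holds W p h5 hord.1 hord.2
    refine ⟨p, hp0, hp, h5, hord, κ, γ, hκ, hγ, hγ', fun D ↦ ?_⟩
    haveI : Module.Finite (IwasawaAlgebra p) D.X := D.module_finite_of_isCyclotomic W κ hκ hγ
    exact stub_semisimpleOfSchneiderAt hPRS hcontrol W p h5 hord κ γ hκ hγ hγ' D
      (hB₃ p hp3 h5 hord κ γ hκ hγ hγ' f hf D) (hB₁ p hp1 hord) Dh hDh (hSch Dh hDh)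

end Summit.BirchSwinnertonDyer.BirchSwinnertonDyer.Cruxes.PinchPrime.FirstLayerStability

end
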